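import Summits.QuantumFields.YangMills.Theorems.BalabanUVNodesN27AtRecord13CoPHHolder
import Summits.QuantumFields.YangMills.Theorems.BalabanUVNodesN14AtTopBornTower

/-!
# BalabanUVNodes ∕ N27 = binder B5 AT THE RECORD — N27 AT dag-n22-e's STAGE-13 `CoPH` RATE READING OF RECORD WITH THE N14 SLOT READ OFF dag-n14-w1's TOP-BORN TOWERS:
# NE1′ ⟸ «the reading's dressed tower `ne1` is TOP-BORN with a bounded top size and a nonnegative rate» (`YMDAG.N14.TopBorn.s_N14_rRec₁₃CoPHOn_of_topBorn`), and
# NE1′ DISCHARGED at the NAMED UNIT-SCALE ASSIGNMENT `ne1 := YMDAG.N14.TopBorn.ne1UnitScale l₀ M Λ hM` up to three sign letters `0 ≤ l₀, 0 ≤ M, 0 ≤ Λ`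
# (`YMDAG.N14.TopBorn.n14At_sourceTower`) — the `ne1` PIN OF RECORD of the K3⁷ skeleton v2 under director-ym №195 (8) reading (a) (plan g78 W-SEAT-START-LIST v4 §2 row n14 WORD,
# pub-ymgap INBOX l.24332: «v2 pins BY NAME `ne1 :=` the tower the N14 lineage declares OF RECORD under (a) = n14-w1's TOP-BORN unit-scale tower at the record»);
# β = 1 (XLᶜᵒᵖᴴ §2 twins) AND R-β ((Q) `…N27AtRecord13CoPHHolder` §2 twins)
# (cell `pub-ymgap`, HUMAN RULING D-0062 Track A, R134 seat `pub-ymgap-dag-n27-c` (N27 B5 composite, s2) gen 11; K3⁷ `SpineGivenEndpointR13SepCoPH` = stmt-QuantumFields-20544,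
# `--kind proof --supports 20544 --as helper`; COUNT-NEUTRAL; THEOREMS ONLY, 0 `def`, 0 `sorry`; `N`-generic, regime-generic, NO Theses import)

WHY.  HOME trigger (t2) of this lineage (HANDOFF §g10): a producer face at the CoPH homes ∕ reading in a NEW currency ⇒ an `_of_<antecedent>` leaf.  dag-n14-w1's
`Thm/BalabanUVNodesN14AtTopBornTower` (p584515 ✓, ns `YMDAG.N14.TopBorn`) is that face for node N14: on a TOP-BORN dressed tower the root-C of record `DressedStabilityStrict` IS
the observable budget `0 ≤ Λ ∧ ∃ A₀ ≥ 0, TowerTopSizeLe 𝒯 A₀` (`dressedStabilityStrict_iff_of_topBorn`), and the decided SOURCE TOWER `sourceTower l₀ M hM` (one insertion of size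
`|t|·M` booked at the unit lattice) carries `N14At` at every `Λ ≥ 0` (`n14At_sourceTower`); its §3 knits both into `S_N14 (RRec₁₃CoPHOn 𝔯 Rg)`.  This file puts them into the
N27 chain at the reading of record `readingOfRecord₁₃CoPH w1 ℓ₃ ne2 ne1` (whose `ne1` component IS `ne1`, `rfl`): XLᶜᵒᵖᴴ §2 `spine_rec13CCoPHOn_at_readingOfRecord₁₃CoPH` (β = 1) and
(Q) §2 `spine_rec13CCoPHOn_at_readingOfRecord₁₃CoPH_holder` (R-β, plan g77 N16-PICK (B)) with the `h14 : S_N14 …` stub REPLACED (a) by the top-born hypothesis on `ne1`, (b) by the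
three sign letters and the pin `hne1 : ne1 F θ g₀ os = ne1UnitScale l₀ M Λ hM F θ hP g₀ os` at every admissible tuple — the first K4 slot of the composite that a consumer closes
with `rfl` and three inequalities instead of an estimate (UNDER READING (a): the file proves what `N14At` is on that tower and that the tower carries it; it does NOT prove that
Bałaban's dressed run is top-born — n14-w1's §4 LOCATED and honest framing apply verbatim).

WHAT IS KERNEL-CHECKED ([bookkeeping]; each ONE application of the parent with n14-w1's ∕ n14-c's knit in the `h14` slot).
* §1 (β = 1, over XLᶜᵒᵖᴴ §2): `spine_rec13CCoPHOn_at_readingOfRecord₁₃CoPH_of_topBornN14` · ★ `spine_rec13CCoPHOn_at_readingOfRecord₁₃CoPH_of_unitScaleN14`.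
* §2 (R-β, over (Q) §2; `h16 : S_N16Holder β …`, `h19` reading `RatesHolderAt … β`): `spine_rec13CCoPHOn_at_readingOfRecord₁₃CoPH_holder_of_topBornN14` ·
  ★★ `spine_rec13CCoPHOn_at_readingOfRecord₁₃CoPH_holder_of_unitScaleN14`.
Consumed BY NAME: `YMDAG.N14.TopBorn.{TowerTopBorn, TowerTopSizeLe, s_N14_rRec₁₃CoPHOn_of_topBorn, ne1UnitScale, n14At_sourceTower}` (p584515), dag-n14-c
`YMDAG.N14.s_N14_rRec₁₃CoPHOn_of_n14At` (`…N14AtRateRecord13CoPHOn`), XLᶜᵒᵖᴴ, (Q).  Nothing landed is edited or re-declared.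

HONEST FRAMING.  COMPOSITE-node bookkeeping BY NAME; no estimate; every other displayed antecedent (NE2, NE3 ∕ NE3 at exponent β, NE5, NE9, (D4), NE7b, NE7c, the extraction
clause, the N19′ core edge) is a HYPOTHESIS inhabited for no family today; the top-born ∕ unit-scale reading of node N14 is the director's ADOPTED TABLE READING (a), not a theorem
about Bałaban's run; nothing of Bałaban's asserted or instantiated; no `Provisos₁₃CoPH` inhabitant claimed (K0⁷ open); N14 ∕ N27 NOT discharged (the chair books, R417); K3⁷ NOT
claimed; v2 NOT registered (plan's); counts UNMOVED (typed 28∕28 · discharged 5∕27, A 5∕28); one finite four-torus programme at fixed `ε` — NOT ℝ⁴, NOT infinite volume, NOT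
OS, NOT a mass gap, NOT Clay.  No decl below carries a cite tag.
-/

set_option autoImplicit false

namespace Summit.QuantumFields.YangMills.Theorems.BalabanUVNodesN27SpineRecord

open Literature.MathematicalPhysics.QuantumFieldTheory.Balaban1983to89
open Literature.MathematicalPhysics.QuantumFieldTheory.Balaban1983to89.T4Continuum
open T4ContinuumYM4Torus (ForSmallCouplings)
open Summit.QuantumFields.BalabanUV.T4Continuum.Spine
open YMDAG.UVSplit
open Node00 (Stage13HParams datumOfRecord₁₃CoPH IsRecordOfRecord₁₃CCoPH IsDatumOfRecord₁₃CCoPH NE3Letters₁₁ NE2Objects₁₁ ne3ConstLayerOfRecord₁₁)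
open Summit.QuantumFields.YangMills.BalabanUVNodes.N16HolderDefs (S_N16Holder)
open Summit.QuantumFields.YangMills.BalabanUVNodes.SpineRatesHolder (RatesHolderAt)
open YMDAG.N14 (s_N14_rRec₁₃CoPHOn_of_n14At)
open YMDAG.N14.TopBorn (TowerTopBorn TowerTopSizeLe s_N14_rRec₁₃CoPHOn_of_topBorn ne1UnitScale n14At_sourceTower)

variable {N : ℕ} [NeZero N] (cr : SpineReading₁₃CoPH N) (β : ℝ)
  (w1 : (F : T4Family) → (θ : Stage13HParams F N) → Node00.W1.ReadingData F (Node00.MatA N) θ.τ9.M) (ℓ₃ : T4Family → NE3Letters₁₁)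
  (ne2 : (F : T4Family) → Stage13HParams F N → (ℕ → ℝ) → List (ULoop F) → ℕ → NE2Objects₁₁)
  (ne1 : (F : T4Family) → Stage13HParams F N → (ℕ → ℝ) → List (ULoop F) → NE1pCarriers)
  (Rg : (F : T4Family) → Stage13HParams F N → Prop)

/-! ## §1 β = 1: XLᶜᵒᵖᴴ §2 with the N14 slot read off dag-n14-w1's top-born towers ∕ the unit-scale assignment -/

/-- **N27 = B5 AT THE REGIME RECORD CLASS FROM THE STUBS AT THE REGIME HOME OF THE READING OF RECORD — N14 ⟸ TOP-BORN** (XLᶜᵒᵖᴴ `spine_rec13CCoPHOn_at_readingOfRecord₁₃CoPH` with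
`h14 := YMDAG.N14.TopBorn.s_N14_rRec₁₃CoPHOn_of_topBorn`): if at every admissible Stage-13 tuple with provisos in `Rg`, every `g₀, os`, the reading's dressed tower `(ne1 F θ g₀ os).𝒯`
is top-born with SOME top-size bound `A₀ ≥ 0` and `0 ≤ (ne1 F θ g₀ os).Λ` (the observable budget — n14-w1 `dressedStabilityStrict_iff_of_topBorn`), then with the other four rate stubs,
(D4), the K5 stubs, the extraction clause and the N19′ edge, `Spine` at `IsRecordOfRecord₁₃CCoPHOn F N Rg`.  Every displayed antecedent a HYPOTHESIS. [bookkeeping] -/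
theorem spine_rec13CCoPHOn_at_readingOfRecord₁₃CoPH_of_topBornN14
    (h14 : ∀ (F : T4Family) (θ : Stage13HParams F N) (hP : θ.Provisos₁₃CoPH F N), Rg F θ → θ.Admissible F N → ∀ (g₀ : ℕ → ℝ) (os : List (ULoop F)),
      ∃ A₀ : ℝ, 0 ≤ A₀ ∧ 0 ≤ (ne1 F θ g₀ os).Λ ∧ TowerTopBorn (ne1 F θ g₀ os).𝒯 ∧ TowerTopSizeLe (ne1 F θ g₀ os).𝒯 A₀)
    (h15 : S_N15 (RRec₁₃CoPHOn (readingOfRecord₁₃CoPH w1 ℓ₃ ne2 ne1) Rg))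
    (h16 : S_N16 (RRec₁₃CoPHOn (readingOfRecord₁₃CoPH w1 ℓ₃ ne2 ne1) Rg)) (h18 : S_N18 (RRec₁₃CoPHOn (readingOfRecord₁₃CoPH w1 ℓ₃ ne2 ne1) Rg))
    (h22 : S_N22 (RRec₁₃CoPHOn (readingOfRecord₁₃CoPH w1 ℓ₃ ne2 ne1) Rg)) (hD4 : S_D4 (RRec₁₃CoPHOn (readingOfRecord₁₃CoPH w1 ℓ₃ ne2 ne1) Rg))
    (h20 : S_N20 (SRec₁₃CoPHOn cr Rg)) (h21 : S_N21 (SRec₁₃CoPHOn cr Rg))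
    (hx : ∀ (F : T4Family) (θ : Stage13HParams F N) (hP : θ.Provisos₁₃CoPH F N), Rg F θ → θ.Admissible F N →
      B16.EndStatementBPrinted (datumOfRecord₁₃CoPH F N θ hP).C → DagBinding.EndpointExistence (datumOfRecord₁₃CoPH F N θ hP).C.toB12 →
        ForSmallCouplings (datumOfRecord₁₃CoPH F N θ hP) fun g₀ => ∀ os : List (ULoop F),
          0 < (cr F θ hP g₀ os).l₀ ∧ 0 < (cr F θ hP g₀ os).vol ∧
          (∀ (K : ℕ) (t : ℝ), |t| ≤ (cr F θ hP g₀ os).l₀ →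
            T4GenFunBounds.schemeZ ((datumOfRecord₁₃CoPH F N θ hP).scheme g₀) os ((cr F θ hP g₀ os).K₀ + K) t =
              ∑ τ ∈ (cr F θ hP g₀ os).T K, (cr F θ hP g₀ os).A K t τ) ∧
          (∀ (K : ℕ) (t : ℝ), |t| ≤ (cr F θ hP g₀ os).l₀ →
            T4GenFunBounds.schemeZ ((datumOfRecord₁₃CoPH F N θ hP).scheme g₀) os ((cr F θ hP g₀ os).K₀ + K + 1) t =
              ∑ τ ∈ (cr F θ hP g₀ os).T K, (cr F θ hP g₀ os).B K t τ))
    (h19 : ∀ (F : T4Family) (θ : Stage13HParams F N) (hP : θ.Provisos₁₃CoPH F N), Rg F θ → θ.Admissible F N → ∀ (g₀ : ℕ → ℝ) (os : List (ULoop F)),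
      (∀ k : ℕ, RatesAt (datumOfRecord₁₃CoPH F N θ hP) (rateCarriersOfRecord₁₃CoPH (readingOfRecord₁₃CoPH w1 ℓ₃ ne2 ne1) F θ hP g₀ os k)) → letI := (cr F θ hP g₀ os).dec
        ∃ δ : ℕ → ℝ, NE7.Core (cr F θ hP g₀ os).l₀ (cr F θ hP g₀ os).vol (cr F θ hP g₀ os).T (cr F θ hP g₀ os).Bad
          (fun K t τ => (cr F θ hP g₀ os).A K t τ - (cr F θ hP g₀ os).shA K t τ) (fun K t τ => (cr F θ hP g₀ os).B K t τ - (cr F θ hP g₀ os).shB K t τ) δ ∧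
          Summable δ) :
    Spine (N := N) fun F D w => Node00.IsRecordOfRecord₁₃CCoPHOn F N Rg D w :=
  spine_rec13CCoPHOn_at_readingOfRecord₁₃CoPH cr w1 ℓ₃ ne2 ne1 Rg (s_N14_rRec₁₃CoPHOn_of_topBorn _ Rg h14) h15 h16 h18 h22 hD4 h20 h21 hx h19

/-- ★ **… N14 DISCHARGED AT THE UNIT-SCALE ASSIGNMENT** (XLᶜᵒᵖᴴ §2 with `h14 :=` dag-n14-c `s_N14_rRec₁₃CoPHOn_of_n14At` ∘ n14-w1 `n14At_sourceTower`): for a reading whose `ne1` IS, at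
every admissible tuple, n14-w1's `ne1UnitScale l₀ M Λ hM` (the one-insertion SOURCE TOWER on the window `|t| ≤ l₀` with observable bound `M`, rate `Λ`; pinned by `hne1`, e.g. `rfl`
at `ne1 := fun F θ _ _ => …`), the N14 slot costs the three sign letters `0 ≤ l₀`, `0 ≤ M`, `0 ≤ Λ` — NOTHING ELSE; every other slot displayed as before.  Reading (a) is the director's
adopted table reading (№195 (8)); nothing of Bałaban's run is asserted to be this tower. [bookkeeping] -/
theorem spine_rec13CCoPHOn_at_readingOfRecord₁₃CoPH_of_unitScaleN14 {l₀ M Λ : ℝ} (hl₀ : 0 ≤ l₀) (hM : 0 ≤ M) (hΛ : 0 ≤ Λ)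
    (h15 : S_N15 (RRec₁₃CoPHOn (readingOfRecord₁₃CoPH w1 ℓ₃ ne2 ne1) Rg))
    (h16 : S_N16 (RRec₁₃CoPHOn (readingOfRecord₁₃CoPH w1 ℓ₃ ne2 ne1) Rg)) (h18 : S_N18 (RRec₁₃CoPHOn (readingOfRecord₁₃CoPH w1 ℓ₃ ne2 ne1) Rg))
    (h22 : S_N22 (RRec₁₃CoPHOn (readingOfRecord₁₃CoPH w1 ℓ₃ ne2 ne1) Rg)) (hD4 : S_D4 (RRec₁₃CoPHOn (readingOfRecord₁₃CoPH w1 ℓ₃ ne2 ne1) Rg))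
    (h20 : S_N20 (SRec₁₃CoPHOn cr Rg)) (h21 : S_N21 (SRec₁₃CoPHOn cr Rg))
    (hx : ∀ (F : T4Family) (θ : Stage13HParams F N) (hP : θ.Provisos₁₃CoPH F N), Rg F θ → θ.Admissible F N →
      B16.EndStatementBPrinted (datumOfRecord₁₃CoPH F N θ hP).C → DagBinding.EndpointExistence (datumOfRecord₁₃CoPH F N θ hP).C.toB12 →
        ForSmallCouplings (datumOfRecord₁₃CoPH F N θ hP) fun g₀ => ∀ os : List (ULoop F),
          0 < (cr F θ hP g₀ os).l₀ ∧ 0 < (cr F θ hP g₀ os).vol ∧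
          (∀ (K : ℕ) (t : ℝ), |t| ≤ (cr F θ hP g₀ os).l₀ →
            T4GenFunBounds.schemeZ ((datumOfRecord₁₃CoPH F N θ hP).scheme g₀) os ((cr F θ hP g₀ os).K₀ + K) t =
              ∑ τ ∈ (cr F θ hP g₀ os).T K, (cr F θ hP g₀ os).A K t τ) ∧
          (∀ (K : ℕ) (t : ℝ), |t| ≤ (cr F θ hP g₀ os).l₀ →
            T4GenFunBounds.schemeZ ((datumOfRecord₁₃CoPH F N θ hP).scheme g₀) os ((cr F θ hP g₀ os).K₀ + K + 1) t =
              ∑ τ ∈ (cr F θ hP g₀ os).T K, (cr F θ hP g₀ os).B K t τ))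
    (h19 : ∀ (F : T4Family) (θ : Stage13HParams F N) (hP : θ.Provisos₁₃CoPH F N), Rg F θ → θ.Admissible F N → ∀ (g₀ : ℕ → ℝ) (os : List (ULoop F)),
      (∀ k : ℕ, RatesAt (datumOfRecord₁₃CoPH F N θ hP) (rateCarriersOfRecord₁₃CoPH (readingOfRecord₁₃CoPH w1 ℓ₃ ne2 ne1) F θ hP g₀ os k)) → letI := (cr F θ hP g₀ os).dec
        ∃ δ : ℕ → ℝ, NE7.Core (cr F θ hP g₀ os).l₀ (cr F θ hP g₀ os).vol (cr F θ hP g₀ os).T (cr F θ hP g₀ os).Bad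
          (fun K t τ => (cr F θ hP g₀ os).A K t τ - (cr F θ hP g₀ os).shA K t τ) (fun K t τ => (cr F θ hP g₀ os).B K t τ - (cr F θ hP g₀ os).shB K t τ) δ ∧
          Summable δ)
    (hne1 : ∀ (F : T4Family) (θ : Stage13HParams F N) (hP : θ.Provisos₁₃CoPH F N), θ.Admissible F N → ∀ (g₀ : ℕ → ℝ) (os : List (ULoop F)),
      ne1 F θ g₀ os = ne1UnitScale l₀ M Λ hM F θ hP g₀ os) :
    Spine (N := N) fun F D w => Node00.IsRecordOfRecord₁₃CCoPHOn F N Rg D w :=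
  spine_rec13CCoPHOn_at_readingOfRecord₁₃CoPH cr w1 ℓ₃ ne2 ne1 Rg
    (s_N14_rRec₁₃CoPHOn_of_n14At _ Rg fun F θ hP _ hθ g₀ os => by
      show N14At (ne1 F θ g₀ os)
      rw [hne1 F θ hP hθ g₀ os]
      exact n14At_sourceTower hl₀ hM hΛ)
    h15 h16 h18 h22 hD4 h20 h21 hx h19

/-! ## §2 R-β (plan g77 N16-PICK (B)): (Q) §2 with the N14 slot read off dag-n14-w1's top-born towers ∕ the unit-scale assignment -/

/-- **THE R-β TWIN OF §1 (TOP-BORN)** ((Q) `spine_rec13CCoPHOn_at_readingOfRecord₁₃CoPH_holder` — `h16 : S_N16Holder β …`, `h19` reading dag-n16-e 41ᴴ `RatesHolderAt … β` — with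
`h14 := YMDAG.N14.TopBorn.s_N14_rRec₁₃CoPHOn_of_topBorn`).  `β` a free letter (the consumers' window `2∕3 < β < 1` is theirs); NE3 at exponent β NOT PROVED. [bookkeeping] -/
theorem spine_rec13CCoPHOn_at_readingOfRecord₁₃CoPH_holder_of_topBornN14
    (h14 : ∀ (F : T4Family) (θ : Stage13HParams F N) (hP : θ.Provisos₁₃CoPH F N), Rg F θ → θ.Admissible F N → ∀ (g₀ : ℕ → ℝ) (os : List (ULoop F)),
      ∃ A₀ : ℝ, 0 ≤ A₀ ∧ 0 ≤ (ne1 F θ g₀ os).Λ ∧ TowerTopBorn (ne1 F θ g₀ os).𝒯 ∧ TowerTopSizeLe (ne1 F θ g₀ os).𝒯 A₀)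
    (h15 : S_N15 (RRec₁₃CoPHOn (readingOfRecord₁₃CoPH w1 ℓ₃ ne2 ne1) Rg))
    (h16 : S_N16Holder β (RRec₁₃CoPHOn (readingOfRecord₁₃CoPH w1 ℓ₃ ne2 ne1) Rg)) (h18 : S_N18 (RRec₁₃CoPHOn (readingOfRecord₁₃CoPH w1 ℓ₃ ne2 ne1) Rg))
    (h22 : S_N22 (RRec₁₃CoPHOn (readingOfRecord₁₃CoPH w1 ℓ₃ ne2 ne1) Rg)) (hD4 : S_D4 (RRec₁₃CoPHOn (readingOfRecord₁₃CoPH w1 ℓ₃ ne2 ne1) Rg))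
    (h20 : S_N20 (SRec₁₃CoPHOn cr Rg)) (h21 : S_N21 (SRec₁₃CoPHOn cr Rg))
    (hx : ∀ (F : T4Family) (θ : Stage13HParams F N) (hP : θ.Provisos₁₃CoPH F N), Rg F θ → θ.Admissible F N →
      B16.EndStatementBPrinted (datumOfRecord₁₃CoPH F N θ hP).C → DagBinding.EndpointExistence (datumOfRecord₁₃CoPH F N θ hP).C.toB12 →
        ForSmallCouplings (datumOfRecord₁₃CoPH F N θ hP) fun g₀ => ∀ os : List (ULoop F),
          0 < (cr F θ hP g₀ os).l₀ ∧ 0 < (cr F θ hP g₀ os).vol ∧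
          (∀ (K : ℕ) (t : ℝ), |t| ≤ (cr F θ hP g₀ os).l₀ →
            T4GenFunBounds.schemeZ ((datumOfRecord₁₃CoPH F N θ hP).scheme g₀) os ((cr F θ hP g₀ os).K₀ + K) t =
              ∑ τ ∈ (cr F θ hP g₀ os).T K, (cr F θ hP g₀ os).A K t τ) ∧
          (∀ (K : ℕ) (t : ℝ), |t| ≤ (cr F θ hP g₀ os).l₀ →
            T4GenFunBounds.schemeZ ((datumOfRecord₁₃CoPH F N θ hP).scheme g₀) os ((cr F θ hP g₀ os).K₀ + K + 1) t =
              ∑ τ ∈ (cr F θ hP g₀ os).T K, (cr F θ hP g₀ os).B K t τ))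
    (h19 : ∀ (F : T4Family) (θ : Stage13HParams F N) (hP : θ.Provisos₁₃CoPH F N), Rg F θ → θ.Admissible F N → ∀ (g₀ : ℕ → ℝ) (os : List (ULoop F)),
      (∀ k : ℕ, RatesHolderAt (datumOfRecord₁₃CoPH F N θ hP) (rateCarriersOfRecord₁₃CoPH (readingOfRecord₁₃CoPH w1 ℓ₃ ne2 ne1) F θ hP g₀ os k) β) → letI := (cr F θ hP g₀ os).dec
        ∃ δ : ℕ → ℝ, NE7.Core (cr F θ hP g₀ os).l₀ (cr F θ hP g₀ os).vol (cr F θ hP g₀ os).T (cr F θ hP g₀ os).Bad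
          (fun K t τ => (cr F θ hP g₀ os).A K t τ - (cr F θ hP g₀ os).shA K t τ) (fun K t τ => (cr F θ hP g₀ os).B K t τ - (cr F θ hP g₀ os).shB K t τ) δ ∧
          Summable δ) :
    Spine (N := N) fun F D w => Node00.IsRecordOfRecord₁₃CCoPHOn F N Rg D w :=
  spine_rec13CCoPHOn_at_readingOfRecord₁₃CoPH_holder cr β w1 ne2 ne1 Rg ℓ₃ (s_N14_rRec₁₃CoPHOn_of_topBorn _ Rg h14) h15 h16 h18 h22 hD4 h20 h21 hx h19

/-- ★★ **THE R-β TWIN OF §1 (UNIT SCALE) — N14 DISCHARGED AT `ne1 := ne1UnitScale l₀ M Λ hM` UP TO `0 ≤ l₀, 0 ≤ M, 0 ≤ Λ`, N16 IN THE CURRENCY OF RECORD R-β** ((Q) §2 with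
`h14 :=` dag-n14-c `s_N14_rRec₁₃CoPHOn_of_n14At` ∘ n14-w1 `n14At_sourceTower`).  What a K3⁷ v2 `stub_rates13H`-side consumer meets at the plan's `ne1` pin of record under reading (a):
the N14 conjunct by `rfl` + three inequalities.  Every other displayed antecedent a HYPOTHESIS (0∕1 today). [bookkeeping] -/
theorem spine_rec13CCoPHOn_at_readingOfRecord₁₃CoPH_holder_of_unitScaleN14 {l₀ M Λ : ℝ} (hl₀ : 0 ≤ l₀) (hM : 0 ≤ M) (hΛ : 0 ≤ Λ)
    (h15 : S_N15 (RRec₁₃CoPHOn (readingOfRecord₁₃CoPH w1 ℓ₃ ne2 ne1) Rg))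
    (h16 : S_N16Holder β (RRec₁₃CoPHOn (readingOfRecord₁₃CoPH w1 ℓ₃ ne2 ne1) Rg)) (h18 : S_N18 (RRec₁₃CoPHOn (readingOfRecord₁₃CoPH w1 ℓ₃ ne2 ne1) Rg))
    (h22 : S_N22 (RRec₁₃CoPHOn (readingOfRecord₁₃CoPH w1 ℓ₃ ne2 ne1) Rg)) (hD4 : S_D4 (RRec₁₃CoPHOn (readingOfRecord₁₃CoPH w1 ℓ₃ ne2 ne1) Rg))
    (h20 : S_N20 (SRec₁₃CoPHOn cr Rg)) (h21 : S_N21 (SRec₁₃CoPHOn cr Rg))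
    (hx : ∀ (F : T4Family) (θ : Stage13HParams F N) (hP : θ.Provisos₁₃CoPH F N), Rg F θ → θ.Admissible F N →
      B16.EndStatementBPrinted (datumOfRecord₁₃CoPH F N θ hP).C → DagBinding.EndpointExistence (datumOfRecord₁₃CoPH F N θ hP).C.toB12 →
        ForSmallCouplings (datumOfRecord₁₃CoPH F N θ hP) fun g₀ => ∀ os : List (ULoop F),
          0 < (cr F θ hP g₀ os).l₀ ∧ 0 < (cr F θ hP g₀ os).vol ∧
          (∀ (K : ℕ) (t : ℝ), |t| ≤ (cr F θ hP g₀ os).l₀ →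
            T4GenFunBounds.schemeZ ((datumOfRecord₁₃CoPH F N θ hP).scheme g₀) os ((cr F θ hP g₀ os).K₀ + K) t =
              ∑ τ ∈ (cr F θ hP g₀ os).T K, (cr F θ hP g₀ os).A K t τ) ∧
          (∀ (K : ℕ) (t : ℝ), |t| ≤ (cr F θ hP g₀ os).l₀ →
            T4GenFunBounds.schemeZ ((datumOfRecord₁₃CoPH F N θ hP).scheme g₀) os ((cr F θ hP g₀ os).K₀ + K + 1) t =
              ∑ τ ∈ (cr F θ hP g₀ os).T K, (cr F θ hP g₀ os).B K t τ))
    (h19 : ∀ (F : T4Family) (θ : Stage13HParams F N) (hP : θ.Provisos₁₃CoPH F N), Rg F θ → θ.Admissible F N → ∀ (g₀ : ℕ → ℝ) (os : List (ULoop F)),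
      (∀ k : ℕ, RatesHolderAt (datumOfRecord₁₃CoPH F N θ hP) (rateCarriersOfRecord₁₃CoPH (readingOfRecord₁₃CoPH w1 ℓ₃ ne2 ne1) F θ hP g₀ os k) β) → letI := (cr F θ hP g₀ os).dec
        ∃ δ : ℕ → ℝ, NE7.Core (cr F θ hP g₀ os).l₀ (cr F θ hP g₀ os).vol (cr F θ hP g₀ os).T (cr F θ hP g₀ os).Bad
          (fun K t τ => (cr F θ hP g₀ os).A K t τ - (cr F θ hP g₀ os).shA K t τ) (fun K t τ => (cr F θ hP g₀ os).B K t τ - (cr F θ hP g₀ os).shB K t τ) δ ∧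
          Summable δ)
    (hne1 : ∀ (F : T4Family) (θ : Stage13HParams F N) (hP : θ.Provisos₁₃CoPH F N), θ.Admissible F N → ∀ (g₀ : ℕ → ℝ) (os : List (ULoop F)),
      ne1 F θ g₀ os = ne1UnitScale l₀ M Λ hM F θ hP g₀ os) :
    Spine (N := N) fun F D w => Node00.IsRecordOfRecord₁₃CCoPHOn F N Rg D w :=
  spine_rec13CCoPHOn_at_readingOfRecord₁₃CoPH_holder cr β w1 ne2 ne1 Rg ℓ₃
    (s_N14_rRec₁₃CoPHOn_of_n14At _ Rg fun F θ hP _ hθ g₀ os => by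
      show N14At (ne1 F θ g₀ os)
      rw [hne1 F θ hP hθ g₀ os]
      exact n14At_sourceTower hl₀ hM hΛ)
    h15 h16 h18 h22 hD4 h20 h21 hx h19

end Summit.QuantumFields.YangMills.Theorems.BalabanUVNodesN27SpineRecord
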